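import Literature.Geometry.Riemannian.PinchingEstimates
import Literature.Geometry.Riemannian.CurvatureDecompositionProofs
import Literature.Geometry.Riemannian.OrthonormalFrameBounds
import Literature.Geometry.Riemannian.PinchingEstimatesTwoSmallestSum
import Literature.Geometry.Riemannian.HamiltonCurvatureODEProofs
import Mathlib.Topology.Instances.Matrix
import HarnessLib

/-!
# The Ricci flow preserves positive isotropic curvature (Hamilton 1997, Thm. B1.2): reduction to `a₁ + a₂ ≥ m`

Companion ("Proofs") file of `Literature/Geometry/Riemannian/RicciFlow.lean` for its named fact
`Literature.Geometry.Riemannian.ricciFlow_preserves_positiveIsotropicCurvature` (**Hamilton 1997,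
§2.1, Thm. 1.2 = Thm. B1.2, first sentence**, Comm. Anal. Geom. 5, p. 7: "The Ricci flow on a
compact 4-manifold preserves positive isotropic curvature"). The printed proof (p. 7) handles
both sentences of Thm. 1.2 at once: "From the ordinary differential inequalities in [3]
`d/dt (a₁ + a₂) ≥ a₁² + a₂² + 2(a₁ + a₂)a₃ + b₁² + b₂²`. Now if `a₁ + a₂ ≥ m > 0` then `a₃ > 0`
also. The set `a₁ + a₂ ≥ m` is convex since `a₁ + a₂` is a concave function of the matrix `A`.
This proves the theorem for `A`, and `C` is the same." In the tree this is the chain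

* Hamilton's maximum principle for systems ([3] = Hamilton 1986, Thm. 4.3) — the named fact
  `hamilton_maximumPrinciple_curvatureODE` (`HamiltonCurvatureODE.lean`), with the ODE
  invariance of `{a₁ + a₂ ≥ m, c₁ + c₂ ≥ m}`, giving
* the second sentence "for any constant `m > 0` the Ricci flow preserves `a₁ + a₂ ≥ m` and
  `c₁ + c₂ ≥ m`" — the named fact `ricciFlow_preserves_twoSmallestEigenvaluesSum_ge`
  (`PinchingEstimates.lean`; since reduced to the maximum principle, ODE invariance included, by
  `ricciFlow_preserves_twoSmallestEigenvaluesSum_ge_of_maximumPrinciple`,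
  `PinchingEstimatesTwoSmallestSum.lean`), from which
* the first sentence follows by Hamilton's Lemma A2.1 (PIC iff `a₁ + a₂ > 0` and `c₁ + c₂ > 0`,
  proved: `hamilton_positiveIsotropicCurvature_iff_blocks_holds`,
  `CurvatureDecompositionProofs.lean`) and compactness of `M` at `t = 0`.

This file proves the last implication, so that the discharge
`ricciFlow_preserves_positiveIsotropicCurvature_holds` is exactly the upstream fact
`ricciFlow_preserves_twoSmallestEigenvaluesSum_ge` — equivalently, by the composite
`ricciFlow_preserves_positiveIsotropicCurvature_of_maximumPrinciple` below, the root fact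
`hamilton_maximumPrinciple_curvatureODE` — away; that root fact being discharged
(`hamilton_maximumPrinciple_curvatureODE_holds`, `HamiltonCurvatureODEProofs.lean`), the file
ends with the discharge itself:

* `isCompact_orthonormalPairs`, `exists_pos_le_twoSmallestEigenvaluesSum_blocks` — on a compact
  manifold with a PIC pair `(g, cov)` there is `m > 0` with `uᵀAu + vᵀAv ≥ m` and
  `uᵀCu + vᵀCv ≥ m` in every orthonormal 4-frame for all orthonormal pairs `u, v ∈ ℝ³` (the Ky
  Fan form of `a₁ + a₂ ≥ m`, `c₁ + c₂ ≥ m` used by `PinchingEstimates.lean`):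
  `exists_pos_le_curvatureFunctional` (`OrthonormalFrameBounds.lean`) applied to the smaller of
  the two Ky Fan sums, a continuous function of the curvature components `Rm(e_a,e_b,e_c,e_d)` of
  the frame, positive by Lemma A2.1 (`twoSmallestEigenvaluesSumPos_blockA/C_of_…`).
* `ricciFlow_preserves_positiveIsotropicCurvature_of_twoSmallestEigenvaluesSum_ge` —
  `ricciFlow_preserves_twoSmallestEigenvaluesSum_ge → ricciFlow_preserves_positiveIsotropicCurvature`:
  bound at `t = 0`, preservation by the hypothesis, `a₁ + a₂ ≥ m > 0 ⇒` PIC of `(g t, cov t)`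
  (`hasPositiveIsotropicCurvatureWith_of_blocks`), and every Levi-Civita connection of `g t` has
  the curvature of `cov t` (`IsLeviCivita.curvature_eq_riemann`, uniqueness of the Levi-Civita
  connection, O'Neill 1983, Thm. 3.11), whence `(g t).HasPositiveIsotropicCurvature`.
* `ricciFlow_preserves_positiveIsotropicCurvature_of_maximumPrinciple` —
  `hamilton_maximumPrinciple_curvatureODE → ricciFlow_preserves_positiveIsotropicCurvature`, the
  composite of the previous theorem with
  `ricciFlow_preserves_twoSmallestEigenvaluesSum_ge_of_maximumPrinciple`: the whole of Thm. 1.2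
  is "[3]" (Hamilton 1986, Thm. 4.3 applied to the curvature of the Ricci flow) away.
* `ricciFlow_preserves_positiveIsotropicCurvature_holds` — the discharge of the named fact: the
  previous theorem fed with the discharge `hamilton_maximumPrinciple_curvatureODE_holds`
  (`HamiltonCurvatureODEProofs.lean`; Hamilton 1986, §4, Thm. 4.3 / Chow–Lu 2004, Thm. 3, for the
  curvature of the Ricci flow on a closed 4-manifold) of "[3]". With it every step of the printed
  proof of Thm. 1.2 (p. 7) is a theorem of the tree.

Nothing in this file's own arguments involves the block `B` (in particular not the sign
convention of the `B^#` term discussed in `HamiltonCurvatureODE.lean`). Not here: the ODE side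
of Thm. 1.2 (`PinchingEstimatesTwoSmallestSum.lean`) and the PDE side (the named fact
`hamilton_maximumPrinciple_curvatureODE`, `HamiltonCurvatureODE.lean`, proved in
`HamiltonCurvatureODEProofs.lean`). No definitions are introduced.

## References

* R. S. Hamilton, *Four-manifolds with positive isotropic curvature*, Comm. Anal. Geom. 5 (1997)
  1–92: §1.2, Lemma 2.1 (p. 5); §2.1, Thm. 1.2 (p. 7) and p. 8 (constants at `t = 0` by
  compactness). [Hamilton1997]
* R. S. Hamilton, *Four-manifolds with positive curvature operator*, J. Differential Geom. 24
  (1986) 153–179, §4, Thm. 4.3 (the maximum principle for systems, "[3]"). [Hamilton1986]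
* B. O'Neill, *Semi-Riemannian geometry with applications to relativity*, Academic Press 1983,
  Ch. 3, Thm. 3.11. [ONeill1983]
-/

noncomputable section

open Bundle Set Function Matrix
open scoped Manifold ContDiff Topology BigOperators

namespace Literature.Geometry.Riemannian

open Lorentzian Lorentzian.PseudoRiemannianMetric

/-! ### A uniform positive lower bound for `a₁ + a₂` and `c₁ + c₂` on a compact PIC manifold -/

section Compactness

variable {E : Type*} [NormedAddCommGroup E] [NormedSpace ℝ E] {H : Type*} [TopologicalSpace H]
  {I : ModelWithCorners ℝ E H} {M : Type*} [TopologicalSpace M] [ChartedSpace H M]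
  [IsManifold I ∞ M] [FiniteDimensional ℝ E] [CompleteSpace E] [T2Space M] [CompactSpace M]
  [LocallyCompactSpace M]
  {g : PseudoRiemannianMetric I ∞ E (TangentSpace I : M → Type _)}
  {cov : CovariantDerivative I E (TangentSpace I : M → Type _)}

/-- The set of orthonormal pairs `(u, v)` of `ℝ³` (`|u| = |v| = 1`, `u ⊥ v`) is compact. [folklore] -/
theorem isCompact_orthonormalPairs :
    IsCompact {y : (Fin 3 → ℝ) × (Fin 3 → ℝ) | y.1 ⬝ᵥ y.1 = 1 ∧ y.2 ⬝ᵥ y.2 = 1 ∧ y.1 ⬝ᵥ y.2 = 0} := by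
  have hclosed : IsClosed
      {y : (Fin 3 → ℝ) × (Fin 3 → ℝ) | y.1 ⬝ᵥ y.1 = 1 ∧ y.2 ⬝ᵥ y.2 = 1 ∧ y.1 ⬝ᵥ y.2 = 0} := by
    refine (isClosed_eq ?_ continuous_const).inter
      ((isClosed_eq ?_ continuous_const).inter (isClosed_eq ?_ continuous_const)) <;> fun_prop
  refine (isCompact_closedBall (0 : (Fin 3 → ℝ) × (Fin 3 → ℝ)) 1).of_isClosed_subset hclosed ?_
  have key : ∀ u : Fin 3 → ℝ, u ⬝ᵥ u = 1 → ‖u‖ ≤ 1 := by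
    intro u hu
    refine (pi_norm_le_iff_of_nonneg zero_le_one).2 fun i ↦ ?_
    have hi : u i * u i ≤ u ⬝ᵥ u :=
      Finset.single_le_sum (f := fun j ↦ u j * u j) (fun j _ ↦ mul_self_nonneg (u j))
        (Finset.mem_univ i)
    rw [hu] at hi
    rw [Real.norm_eq_abs]
    exact abs_le_one_iff_mul_self_le_one.2 hi
  rintro ⟨u, v⟩ ⟨hu, hv, -⟩
  rw [mem_closedBall_zero_iff, Prod.norm_def]
  exact max_le (key u hu) (key v hv)

/-- **Uniform `a₁ + a₂ ≥ m > 0`, `c₁ + c₂ ≥ m > 0` on a compact PIC manifold** (the compactness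
step of Hamilton 1997, §2.1, implicit in Thm. 1.2 and spelled out on p. 8: "if `M⁴` is compact
and `a₁ + a₂ > 0` and `c₁ + c₂ > 0` at `t = 0`, there is some constant … so that the estimate
indeed holds at `t = 0`"). For a Riemannian `C^∞` metric `g` with Levi-Civita connection `cov`
and positive isotropic curvature on a compact manifold, there is `m > 0` such that in every
`g`-orthonormal 4-frame the blocks `A` and `C` satisfy `uᵀAu + vᵀAv ≥ m` and `uᵀCu + vᵀCv ≥ m`
for all orthonormal pairs `u, v ∈ ℝ³` (Ky Fan form of `a₁ + a₂ ≥ m`, `c₁ + c₂ ≥ m`): by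
Hamilton's Lemma A2.1 (`twoSmallestEigenvaluesSumPos_blockA/C_of_hasPositiveIsotropicCurvatureWith`)
the sums are positive, they are continuous functions of the curvature components of the frame,
and `exists_pos_le_curvatureFunctional` applies. [cite: Hamilton1997, §2.1, Thm. 1.2 (p. 7) and p. 8] -/
theorem exists_pos_le_twoSmallestEigenvaluesSum_blocks (hg : g.IsRiemannian)
    (hcov : g.IsLeviCivita cov) (hPIC : g.HasPositiveIsotropicCurvatureWith cov) :
    ∃ m : ℝ, 0 < m ∧ ∀ (x : M) (e : Fin 4 → TangentSpace I x), g.IsOrthonormalFrame x e →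
      ∀ u v : Fin 3 → ℝ, u ⬝ᵥ u = 1 → v ⬝ᵥ v = 1 → u ⬝ᵥ v = 0 →
        m ≤ u ⬝ᵥ (g.blockA cov x e *ᵥ u) + v ⬝ᵥ (g.blockA cov x e *ᵥ v) ∧
        m ≤ u ⬝ᵥ (g.blockC cov x e *ᵥ u) + v ⬝ᵥ (g.blockC cov x e *ᵥ v) := by
  have hn : (2 : ℕ∞ω) ≤ ∞ := WithTop.coe_le_coe.mpr le_top
  -- index tables of Hamilton's bases `φᵢ` (self-dual) and `ψᵢ` (anti-self-dual):
  -- `selfDualPairs e i a = (e (σ₁ i a), e (σ₂ i a))`, `antiSelfDualPairs e i a = (e (τ₁ i a), e (τ₂ i a))`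
  set σ₁ : Fin 3 → Fin 2 → Fin 4 := ![![0, 2], ![0, 3], ![0, 1]] with hσ₁
  set σ₂ : Fin 3 → Fin 2 → Fin 4 := ![![1, 3], ![2, 1], ![3, 2]] with hσ₂
  set τ₁ : Fin 3 → Fin 2 → Fin 4 := ![![0, 3], ![0, 1], ![0, 2]] with hτ₁
  set τ₂ : Fin 3 → Fin 2 → Fin 4 := ![![1, 2], ![2, 3], ![3, 1]] with hτ₂
  -- the blocks as functions of the curvature components `R a b c d = Rm(e_a, e_b, e_c, e_d)`
  set MA : (Fin 4 → Fin 4 → Fin 4 → Fin 4 → ℝ) → Matrix (Fin 3) (Fin 3) ℝ := fun R ↦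
    Matrix.of fun i j ↦ ∑ a, ∑ b, R (σ₁ i a) (σ₂ i a) (σ₂ j b) (σ₁ j b) with hMA
  set MC : (Fin 4 → Fin 4 → Fin 4 → Fin 4 → ℝ) → Matrix (Fin 3) (Fin 3) ℝ := fun R ↦
    Matrix.of fun i j ↦ ∑ a, ∑ b, R (τ₁ i a) (τ₂ i a) (τ₂ j b) (τ₁ j b) with hMC
  have hA : ∀ (x : M) (e : Fin 4 → TangentSpace I x),
      MA (fun a b c d ↦ g.curvatureForm cov x (e a) (e b) (e c) (e d)) = g.blockA cov x e := by
    intro x e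
    ext i j
    fin_cases i <;> fin_cases j <;>
      simp [hMA, hσ₁, hσ₂, blockA, pairingCurvature, bivectorCurvature, selfDualPairs,
        Fin.sum_univ_two]
  have hC : ∀ (x : M) (e : Fin 4 → TangentSpace I x),
      MC (fun a b c d ↦ g.curvatureForm cov x (e a) (e b) (e c) (e d)) = g.blockC cov x e := by
    intro x e
    ext i j
    fin_cases i <;> fin_cases j <;>
      simp [hMC, hτ₁, hτ₂, blockC, pairingCurvature, bivectorCurvature, antiSelfDualPairs,
        Fin.sum_univ_two]
  -- the functional: the smaller of the two Ky Fan sums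
  set F : (Fin 4 → Fin 4 → Fin 4 → Fin 4 → ℝ) → (Fin 3 → ℝ) × (Fin 3 → ℝ) → ℝ := fun R y ↦
    min (y.1 ⬝ᵥ (MA R *ᵥ y.1) + y.2 ⬝ᵥ (MA R *ᵥ y.2))
      (y.1 ⬝ᵥ (MC R *ᵥ y.1) + y.2 ⬝ᵥ (MC R *ᵥ y.2)) with hF
  have hRcont : ∀ a b c d : Fin 4,
      Continuous fun R : Fin 4 → Fin 4 → Fin 4 → Fin 4 → ℝ ↦ R a b c d := fun a b c d ↦
    (continuous_apply d).comp ((continuous_apply c).comp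
      ((continuous_apply b).comp (continuous_apply a)))
  have hMAcont : Continuous MA := by
    refine continuous_matrix fun i j ↦ ?_
    simp only [hMA, Matrix.of_apply]
    exact continuous_finsetSum _ fun a _ ↦ continuous_finsetSum _ fun b _ ↦ hRcont _ _ _ _
  have hMCcont : Continuous MC := by
    refine continuous_matrix fun i j ↦ ?_
    simp only [hMC, Matrix.of_apply]
    exact continuous_finsetSum _ fun a _ ↦ continuous_finsetSum _ fun b _ ↦ hRcont _ _ _ _
  have hFcont : Continuous (uncurry F) := by
    have h1 : Continuous fun p : (Fin 4 → Fin 4 → Fin 4 → Fin 4 → ℝ) × ((Fin 3 → ℝ) × (Fin 3 → ℝ)) ↦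
        p.2.1 ⬝ᵥ (MA p.1 *ᵥ p.2.1) + p.2.2 ⬝ᵥ (MA p.1 *ᵥ p.2.2) := by
      have hM : Continuous fun p : (Fin 4 → Fin 4 → Fin 4 → Fin 4 → ℝ) ×
          ((Fin 3 → ℝ) × (Fin 3 → ℝ)) ↦ MA p.1 := hMAcont.comp continuous_fst
      exact ((continuous_fst.comp continuous_snd).dotProduct
        (hM.matrix_mulVec (continuous_fst.comp continuous_snd))).add
        ((continuous_snd.comp continuous_snd).dotProduct
          (hM.matrix_mulVec (continuous_snd.comp continuous_snd)))
    have h2 : Continuous fun p : (Fin 4 → Fin 4 → Fin 4 → Fin 4 → ℝ) × ((Fin 3 → ℝ) × (Fin 3 → ℝ)) ↦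
        p.2.1 ⬝ᵥ (MC p.1 *ᵥ p.2.1) + p.2.2 ⬝ᵥ (MC p.1 *ᵥ p.2.2) := by
      have hM : Continuous fun p : (Fin 4 → Fin 4 → Fin 4 → Fin 4 → ℝ) ×
          ((Fin 3 → ℝ) × (Fin 3 → ℝ)) ↦ MC p.1 := hMCcont.comp continuous_fst
      exact ((continuous_fst.comp continuous_snd).dotProduct
        (hM.matrix_mulVec (continuous_fst.comp continuous_snd))).add
        ((continuous_snd.comp continuous_snd).dotProduct
          (hM.matrix_mulVec (continuous_snd.comp continuous_snd)))
    exact h1.min h2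
  -- the compact parameter set of orthonormal pairs
  set K : Set ((Fin 3 → ℝ) × (Fin 3 → ℝ)) :=
    {y | y.1 ⬝ᵥ y.1 = 1 ∧ y.2 ⬝ᵥ y.2 = 1 ∧ y.1 ⬝ᵥ y.2 = 0} with hK
  have hKc : IsCompact K := isCompact_orthonormalPairs
  -- positivity: Hamilton's Lemma A2.1
  have hpos : ∀ (x : M) (e : Fin 4 → TangentSpace I x), g.IsOrthonormalFrame x e → ∀ y ∈ K,
      0 < F (fun a b c d ↦ g.curvatureForm cov x (e a) (e b) (e c) (e d)) y := by
    intro x e he y hy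
    simp only [hF, hA x e, hC x e]
    exact lt_min
      (twoSmallestEigenvaluesSumPos_blockA_of_hasPositiveIsotropicCurvatureWith hcov hn hPIC x he
        y.1 y.2 hy.1 hy.2.1 hy.2.2)
      (twoSmallestEigenvaluesSumPos_blockC_of_hasPositiveIsotropicCurvatureWith hcov hn hPIC x he
        y.1 y.2 hy.1 hy.2.1 hy.2.2)
  obtain ⟨m, hm, hmle⟩ :=
    exists_pos_le_curvatureFunctional hg hcov hKc hFcont.continuousOn hpos
  refine ⟨m, hm, fun x e he u v hu hv huv ↦ ?_⟩
  have := hmle x e he (u, v) ⟨hu, hv, huv⟩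
  simp only [hF, hA x e, hC x e, le_min_iff] at this
  exact this

end Compactness

/-! ### Preservation of PIC from preservation of `a₁ + a₂ ≥ m`, `c₁ + c₂ ≥ m` -/

universe u

/-- **Hamilton 1997, Thm. B1.2, first sentence from the second.** "The Ricci flow on a compact
4-manifold preserves positive isotropic curvature" (`ricciFlow_preserves_positiveIsotropicCurvature`,
`RicciFlow.lean`) follows from "for any constant `m > 0` the Ricci flow preserves the
inequalities `a₁ + a₂ ≥ m` and `c₁ + c₂ ≥ m`" (the named fact
`ricciFlow_preserves_twoSmallestEigenvaluesSum_ge`, `PinchingEstimates.lean`, taken as the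
hypothesis `h`): at `t = 0` positive isotropic curvature gives `a₁ + a₂ > 0`, `c₁ + c₂ > 0` in
every orthonormal frame (Hamilton's Lemma A2.1, `hamilton_positiveIsotropicCurvature_iff_blocks_holds`),
hence `≥ m` for some `m > 0` by compactness (`exists_pos_le_twoSmallestEigenvaluesSum_blocks`);
by `h` the inequalities hold at every `t ∈ [0, T)` for the blocks of `(g t, cov t)`, hence
`a₁ + a₂ > 0` and PIC of `(g t, cov t)` by Lemma A2.1 again; finally every Levi-Civita
connection of `g t` has the curvature tensor of `cov t` (`IsLeviCivita.curvature_eq_riemann`,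
uniqueness of the Levi-Civita connection), so `g t` has positive isotropic curvature.
[cite: Hamilton1997, §2.1, Thm. 1.2 (p. 7)] -/
theorem ricciFlow_preserves_positiveIsotropicCurvature_of_twoSmallestEigenvaluesSum_ge
    (h : ricciFlow_preserves_twoSmallestEigenvaluesSum_ge.{u}) :
    ricciFlow_preserves_positiveIsotropicCurvature.{u} := by
  intro M _ _ _ _ _ _ T g cov hRF hRiem hPIC t ht
  haveI : LocallyCompactSpace M := ChartedSpace.locallyCompactSpace (EuclideanSpace ℝ (Fin 4)) M
  have hn : (2 : ℕ∞ω) ≤ ∞ := WithTop.coe_le_coe.mpr le_top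
  have h0 : (0 : ℝ) ∈ Ico 0 T := ⟨le_rfl, ht.1.trans_lt ht.2⟩
  have hLC0 : (g 0).IsLeviCivita (cov 0) := hRF.isLeviCivita 0 h0
  have hPIC0 : (g 0).HasPositiveIsotropicCurvatureWith (cov 0) := hPIC (cov 0) hLC0
  -- uniform lower bound at `t = 0`
  obtain ⟨m, hm, hmle⟩ :=
    exists_pos_le_twoSmallestEigenvaluesSum_blocks (hRiem 0 h0) hLC0 hPIC0
  -- preserved along the flow
  have hmt := h M T g cov hRF hRiem m hm hmle t ht
  -- PIC of `(g t, cov')` for every Levi-Civita connection `cov'` of `g t`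
  intro cov' hcov'
  have hLCt : (g t).IsLeviCivita (cov t) := hRF.isLeviCivita t ht
  haveI := (g t).hasLeviCivita
  have hcurv : ∀ x, cov'.curvature x = (cov t).curvature x := fun x ↦ by
    rw [hcov'.curvature_eq_riemann hn x, hLCt.curvature_eq_riemann hn x]
  refine hasPositiveIsotropicCurvatureWith_of_blocks hcov' hn fun x e he u v hu hv huv ↦ ?_
  have hA : (g t).blockA cov' x e = (g t).blockA (cov t) x e := by
    simp only [blockA, pairingCurvature, bivectorCurvature, curvatureForm, hcurv x]
  rw [hA]
  exact lt_of_lt_of_le hm (hmt x e he u v hu hv huv).1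

/-- **Hamilton 1997, Thm. B1.2, first sentence, from the maximum principle for systems.** "The
Ricci flow on a compact 4-manifold preserves positive isotropic curvature"
(`ricciFlow_preserves_positiveIsotropicCurvature`) follows from Hamilton's maximum principle for
systems applied to the curvature ODE of the Ricci flow (the named fact
`hamilton_maximumPrinciple_curvatureODE`, `HamiltonCurvatureODE.lean`; "[3]" = Hamilton 1986,
Thm. 4.3, in the printed proof, p. 7): the second sentence of Thm. 1.2 follows from it
(`ricciFlow_preserves_twoSmallestEigenvaluesSum_ge_of_maximumPrinciple`,
`PinchingEstimatesTwoSmallestSum.lean`: the ODE inequality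
`d/dt (a₁ + a₂) ≥ a₁² + a₂² + 2(a₁ + a₂)a₃ + b₁² + b₂²` and the convexity of `{a₁ + a₂ ≥ m}`),
and the first from the second
(`ricciFlow_preserves_positiveIsotropicCurvature_of_twoSmallestEigenvaluesSum_ge`).
[cite: Hamilton1997, §2.1, Thm. 1.2 (p. 7)] [cite: Hamilton1986, §4, Thm. 4.3 (p. 162)] -/
theorem ricciFlow_preserves_positiveIsotropicCurvature_of_maximumPrinciple
    (hMP : hamilton_maximumPrinciple_curvatureODE.{u}) :
    ricciFlow_preserves_positiveIsotropicCurvature.{u} :=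
  ricciFlow_preserves_positiveIsotropicCurvature_of_twoSmallestEigenvaluesSum_ge
    (ricciFlow_preserves_twoSmallestEigenvaluesSum_ge_of_maximumPrinciple hMP)

/-- **Hamilton 1997, §2.1, Thm. 1.2 (= Thm. B1.2), first sentence** — "The Ricci flow on a compact
4-manifold preserves positive isotropic curvature": the named fact
`ricciFlow_preserves_positiveIsotropicCurvature` (`RicciFlow.lean`) holds. The printed proof
(p. 7) verbatim: the maximum principle for systems "[3]" (Hamilton 1986, §4, Thm. 4.3, applied to
the curvature ODE of the Ricci flow — the discharged fact
`hamilton_maximumPrinciple_curvatureODE_holds`, `HamiltonCurvatureODEProofs.lean`) preserves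
`a₁ + a₂ ≥ m` and `c₁ + c₂ ≥ m` because of the ODE inequality
`d/dt (a₁ + a₂) ≥ a₁² + a₂² + 2(a₁ + a₂)a₃ + b₁² + b₂²` and the concavity of `a₁ + a₂`
(`ricciFlow_preserves_twoSmallestEigenvaluesSum_ge_of_maximumPrinciple`), and positive isotropic
curvature at `t = 0` gives such an `m > 0` by compactness and Lemma A2.1, which converts the
preserved bounds back into positive isotropic curvature at every later time
(`ricciFlow_preserves_positiveIsotropicCurvature_of_twoSmallestEigenvaluesSum_ge`).
[cite: Hamilton1997, §2.1, Thm. 1.2 (p. 7)] [cite: Hamilton1986, §4, Thm. 4.3 (p. 162)] -/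
theorem ricciFlow_preserves_positiveIsotropicCurvature_holds :
    ricciFlow_preserves_positiveIsotropicCurvature.{u} :=
  ricciFlow_preserves_positiveIsotropicCurvature_of_maximumPrinciple
    hamilton_maximumPrinciple_curvatureODE_holds

end Literature.Geometry.Riemannian

end
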